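import Summits.HodgeConjecture.HodgeConjecture.Theses.VHCAbelianSchemesRoad
import Summits.HodgeConjecture.HodgeConjecture.Theorems.VHCAbelianSchemesRoadLocallyServedAnchor
import Summits.HodgeConjecture.HodgeConjecture.Theorems.VHCAbelianSchemesRoadSecantQuotientAnchorPinnedDefs
import Summits.HodgeConjecture.HodgeConjecture.Theorems.VHCAbelianSchemesRoadTwistedDoorPrimeIsoRespects
import Summits.HodgeConjecture.HodgeConjecture.Theorems.VHCAbelianSchemesRoadLocallyServedAnchorCarriedPair
import Summits.HodgeConjecture.HodgeConjecture.Theorems.VHCAbelianSchemesRoadSecantQuotientOffHyperellipticOfPrintForall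
import HarnessLib

/-!
# BC3 skeleton v3.7 = D1b (director-hodge g12 RULING R12.5, 2026-08-28; BY NAME over `LocallyServedAt` ∕ `AnchoredSpanAt` ∕ `AnchorReachableAt` ∕
# `carriedClasses`, the anchor family RESTRICTED TO OFF-HYPERELLIPTIC PRESENTATIONS) for the LOCAL-IN-THE-FIBRE deciding crux
# `SemiregularSheafRepresentativesTwPrimeAtDiagLocal` (route `VHCAbelianSchemesRoad`, rev 26 unchanged, tribunal round 4 PASS tier B; LEAD 160 =
# planner-pub-hodge-ring2-typer1-g158-0; kernel inputs of ring2-b03x g8 p590217 `…OneCarriedSeedTransfer` ∕ p590722 `…SecantQuotientOffHyperellipticOfPrintForall`,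
# ring2-b03x g7 p587622, ab-andre-2 g66 p583871 ∕ p584635, ring2-b03 g87 `…SecantQuotientHyperellipticLevelTransferDefs`)

research route conditional on HC_CM; not a corollary; Q11.4-sentence-2 already refuted in dim ≥ 3.

WHY v3.7 (R12.5 (1)–(2)). ring2-b03x g8 (evidence #12 `TWOAPRIME0-b03x-g8.md`) showed in kernel that v3.6's stub 2a′₀ («one carried pinned-served class at
EVERY pinned anchor») is, modulo print's pinned claim L1″, EXACTLY the tree's one-direction same-level transfer node G1♭′
(`oneCarried_63_twPrime_iff_pinnedLevelTransfer63PinnedPrime_of_markmanPinned`), that G1♭′ ⟺ Off′ ∧ At′ (hyperelliptic split, ring2-b03 g87), and that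
Off′ follows FACT-FREE from print READ IN ∀-FORM over NON-hyperelliptic data with the pin prescribed (`offHyperellipticPinnedPrime_of_markmanPinnedForall`,
displayed hypothesis `hMall` = L1″_∀) — so modulo print in both forms 2a′₀ ≡ At′ = carried-ness AT HYPERELLIPTIC-PRESENTED pinned anchors, where print
is silent and where the Bloch kernel of print's own sheaf is known to be non-zero («Bloch kernel ⟺ hyperelliptic», memo `L1PP-b03x-g7.md` (iii),
`REFUTE-MARKMAN-G10-T.md` §2). The director asked the LEAD to decide, by ONE CONSUMER CHECK, whether At′ is load-bearing.

THE CONSUMER CHECK (settled from the typed definitions; consumer NAMED). The ONLY consumer of the span statement 2s′ downstream is ab-andre-2 g66's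
`lefAtExceptionalRegimeAtLocal_of_anchoredSpan_of_residual` through `LocallyServedAt.of_anchorReachable` (p583871, generic in the anchor family `𝔄`):
span data AT an anchor `(Y, θ_Y)` are consumed only when a pair `(X, w)` is `AnchorReachableAt 6 3 𝔄 𝔘 𝔏 X w`, i.e. joined to that anchor by a
PENCIL over a smooth irreducible affine curve whose fibre `X'_{s₁} ≅ Y` satisfies `𝔄 Y θ_Y` (with the polarisation, the transportable directions and
a joining class extended over the pencil), and the output `LocallyServedAt (tw C AdmTw′) 6 3 X w` places the admissible data at OTHER fibres `s i` of a
pencil through `X` — never at `(X, w)` itself. Hence carried-ness at a hyperelliptic-presented anchor is used only if a reachability pencil is made to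
hit the anchor family AT the hyperelliptic divisor; every reachability mechanism on the table (case-(A) Weil-cell pencils inside the connected level
family ∕ the Shimura component, where `W_K` is a constant system) chooses the anchor fibre freely in a Zariski-dense subset of the irreducible level
family, and the off-hyperelliptic presentations are such a subset (hyperelliptic genus-3 curves form a divisor of `M₃`; `…HyperellipticLevelTransferDefs`
module docstring). VERDICT: «DENSITY ONLY» — At′ is NOT load-bearing ⇒ **D1b**. Typed cost, stated honestly: the residual stub 2r′ is re-domained to
the complement of reachability FROM OFF-HYPERELLIPTIC-PRESENTED anchors (formally more pairs; in content the same (R3) list, since a pair reachable from a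
hyperelliptic-presented anchor by a pencil in the level family is reachable from its off-hyperelliptic neighbours by the same kind of pencil), and the
hyperelliptic-presented anchors themselves become ordinary pairs of 2r′'s domain unless reachable. At′ (`SecantQuotientPinnedAnchorLevelTransfer63AtHyperellipticPinnedPrime`)
LEAVES THE ROUTE (one print-silent research statement fewer); D1a (= 2ℓ′ + 2h′ At′ by name + L1″ seed, 2a′₀ derived by
`oneCarried_63_twPrime_of_markmanPinned_of_markmanPinnedForall_of_atHyperelliptic`) is the named alternative should a consumer at the divisor ever appear.

REGISTERED STUBS (FIVE; (G1′)∕(G1♭′) no longer inside any stub — the off-hyperelliptic half is served by 2ℓ′ directly, the at-hyperelliptic half left):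
* **1′ `stub_firstCell_fourfoldMiddleTwPrime`** — `LefAtExceptionalRegimeAt (tw C AdmTw′) 4 2` (single datum; no print contact). XL. Unchanged.
* **2ℓ′ `stub_markmanPinnedForall_TwPrime`** (NEW, R12.5 (2); PRINT-KEYED; signature = p590722's displayed hypothesis `hMall` VERBATIM at the primed door,
  `∀ C`) — L1″_∀(C, AdmTw′): Markman's pinned claim (PREPRINT arXiv:2502.03415, Thm. 1.4.1 item 4 ∕ Thm. 1.5.1 ∕ §9) with its leading `∃` over the
  construction data read as `∀` over NON-HYPERELLIPTIC genus-3 secant–quotient data in general position and the pin PRESCRIBED. Typing-bound on ONE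
  print-faithfulness question = refute-markman WAKE #8 (R12.5 (3)): do Assumption 9.1.1 ∕ Lemma 9.1.2 («generic choice of the `Cᵢ`'s», made INSIDE the
  construction at a fixed datum) and Lemma 9.3.1 hold at EVERY non-hyperelliptic datum with the pin prescribed? FORALL-FAITHFUL ⇒ the typer may key
  L1″_∀ as a cite-tagged Literature claim and 2ℓ′ closes BY NAME (zero glue: `hMall` is spelled in the claim-fact's own binders); GENERIC-ONLY ⇒ 2ℓ′
  stays a research stub displaying the extra hypothesis. Why it might fail: exactly that genericity clause; and L1″ itself is a preprint claim under
  review (admissibility of `𝓔̄` in `AdmTw′` at the §4.4-generic datum HOLDS on paper, THEOREM T ×2, O₁). Size S modulo print.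
* **2m′ᵒ `stub_secondCarried_63_secantQuotientPinnedOffHypPrime`** (= R12.3's 2m′, the route's T3 PLAN-ONLY designate, anchor family restricted per
  D1b) — THE MOVER with the span clause: at every pinned anchor PRESENTED BY A NON-HYPERELLIPTIC DATUM, one carried pinned-served class `γ₁` ⟹ a second
  carried pinned-served class `γ₂` with `𝔖^pin ⊆ ℂγ₁ + ℂγ₂ + ℂθ³`. In-house, NOT print: `(ḡ_u)_*𝓔̄`, `u = 2+φ₄` at `d = 4` (d-uniform `u = 3+φ_d`),
  THEOREM M (a) `W_ℚ(Y₄) = ℚγ₀ ⊕ ℚγ₁`; HOLDS ON PAPER at `d = 4` conditional on L1″ ∧ (C_u^∨)₄-in-degree-2 at the §4.4-generic datum by THEOREM T ×2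
  (ring2-b03x g7 #6; refute-markman #9 PASS, wording objection O₁: off the §4.4-open set — non-hyperelliptic `C`, `p ≠ q`, `4(p−q) ∼ 0` or
  `8(p−q) ∼ 0` — the pair «`𝓔̄` alive, mover dead» is UNDECIDED; that set is INSIDE this stub's domain); typing-bound (no kernel object for `𝓔̄`, `ḡ_u`).
* **2r′ᵒ `stub_localResidualPairs_63_OffHypTwPrime`** (= 2r′ re-domained per D1b) — every pair (`X` ≅ abelian sixfold, `w` rational (3,3)) NEITHER
  algebraic-Lefschetz NOR `AnchorReachableAt 6 3 𝔄^{pin,off} 𝔖^pin (𝔖^pin + ℂθ³) X w` is `LocallyServedAt (tw C AdmTw′) 6 3 X w`. XL, the honest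
  residual ((R3) general even `d ≥ 6` second directions, Weil type outside print's components, non-Weil exceptional classes, non-`θ³` Lefschetz parts,
  unreachable fibres — now including any hyperelliptic-presented anchor no pencil reaches); NO object proposed.
* **3′ᴸ `stub_diagonalTailTwPrimeLocal`** — `m ≥ 4`. XL. Unchanged.
DERIVED IN-FILE (kernel-checked, hypothesis form): Off′(C) from 2ℓ′ (`offHypPinnedPrime_of_stub`, p590722); 2a′₀ᵒ = one carried pinned-served class at
every off-hyperelliptic-presented pinned anchor from 2ℓ′ ALONE — no seed, no transfer (`oneCarried_63_offHyp_of_stub`,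
`oneCarried_63_twPrime_at_presentedOffHyperelliptic_of_markmanPinnedForall`); 2s′ᵒ = `AnchoredSpanAt (tw C AdmTw′) 6 3 𝔄^{pin,off} 𝔖^pin (𝔖^pin + ℂθ³)`
from 2a′₀ᵒ ∧ 2m′ᵒ (`anchoredSpan_63_secantQuotientPinnedOffHypPrime_of_stubs`, ring2-b03x g7's generic `anchoredSpanAt_served_of_two_carried_served`);
the `(6,3)` cell `localCell_sixfoldMiddleOffHypTwPrime_of_cells` = ONE term of `lefAtExceptionalRegimeAtLocal_of_anchoredSpan_of_residual` with
`h𝒪 := twistedDoorPrime_respectsIso C`; the composition `SemiregularSheafRepresentativesTwPrimeAtDiagLocal_of` concludes the ROUTE DECL BY NAME from the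
FIVE registered stubs; `sorryAx` reaches it only through `stub_*`. 𝔄^{pin,off} Y θ := `secantQuotientAnchorsPinned Y θ ∧ ∃ D e θ₀, ¬ D.𝒥.IsHyperelliptic
∧ D.𝒥.J.IsPolarizationClassOf D.Θ θ₀ ∧ e⁻¹^*θ = D.hY θ₀` (p590722's presentation clause verbatim; spelled out, no new def). HYGIENE (director l.5406):
(h1) isotrivial ⇒ pointwise — neither branch free; (h2) `k = 0` ⇒ on-path Lefschetz. Superseded: v3.6a (736a521450bea1c9), v3.6 (d90a822216f4b6c6),
v3.5.1, v3.5.0 on 23176. Nothing here is claimed: the stubs are `sorry`, L1″ ∕ L1″_∀ are preprint claims in hypothesis form, the door binder 20706 and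
`HC_CM` are untouched, `HC_AV` ∕ `HC` are not asserted; HC_CM HELD, by name only; typed ≠ proved.
-/

open CategoryTheory CategoryTheory.Limits AlgebraicGeometry Topology
open Literature.AlgebraicGeometry Literature.AlgebraicGeometry.Motives Literature.AlgebraicGeometry.Motives.AbelianVariety
open Literature.AlgebraicGeometry.HodgeTheory Literature.AlgebraicGeometry.Markman2025
open Literature.AlgebraicTopology.SingularHomology
open Literature.Barriers.HodgeConjecture (divisorClassesSpan)
open Summit.HodgeConjecture.HodgeConjecture.Ring2.SemiregularRepresentatives

namespace Summit.HodgeConjecture.HodgeConjecture.Cruxes.SemiregularSheafRepresentativesTwPrimeAtDiagLocal.Birth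

set_option linter.dupNamespace false

/-- STUB 1′ (size XL, research; MECHANISM cell, ONE carrier — unchanged in kind from v3.3 ∕ v3.5.0): regime 2 (single datum) over the PRIMED
twisted door at `(4, 2)` — abelian fourfold pencils, codimension 2. No candidate carrier in print. -/
theorem stub_firstCell_fourfoldMiddleTwPrime : ∀ C : ChernCharacterBetti,
    LefAtExceptionalRegimeAt (twistedReflexiveClass C (fun n X₀ I E => Summit.Ventures.HSemireg.gluableSigmaAdmissible n X₀ I E ∨ bfSingleAdmissible' n X₀ I E)) 4 2 := by
  sorry

/-- STUB 2ℓ′ (NEW v3.7, R12.5 (2); PRINT-KEYED — the signature is p590722's displayed hypothesis `hMall` VERBATIM at the primed door, `∀ C`):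
**L1″_∀(C, AdmTw′)** — Markman's pinned secant–quotient carrier claim (PREPRINT arXiv:2502.03415; Thm. 1.4.1 item 4, Thm. 1.5.1, §9) with its leading `∃`
over the construction data read as `∀` over NON-HYPERELLIPTIC genus-3 data in general position and with the pin PRESCRIBED. Closes BY NAME with zero glue
if the typer files L1″_∀ as a cite-tagged claim-fact (refute-markman WAKE #8 decides FORALL-FAITHFUL vs GENERIC-ONLY: Assumption 9.1.1 ∕ Lemma 9.1.2 and
Lemma 9.3.1 at EVERY non-hyperelliptic datum?). Why it might fail: that genericity clause (then an extra displayed hypothesis), and the preprint's claim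
itself (L1″; admissibility of `𝓔̄` in `AdmTw′` HOLDS on paper at the §4.4-generic datum, THEOREM T ×2 with O₁). Size S modulo print. -/
theorem stub_markmanPinnedForall_TwPrime : ∀ C : ChernCharacterBetti,
    ∀ d : ℕ, Even d → 4 ≤ d →
      ∀ (Cᵥ : SchemeOver ℂ) (_ : IsSmoothProjective 1 Cᵥ) (𝒥 : Jacobian Cᵥ) (_ : 𝒥.J.dim = 3)
        (Θ : CartierDivisor 𝒥.J.X.left) (_ : 𝒥.IsRiemannThetaDivisor Θ) (hP : 𝒥.J.IsPrincipalPolarizationDivisor Θ)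
        (G₁ G₂ : Subgroup (𝒥.J.Points ℂ)) (h₁ : G₁ ≤ 𝒥.J.torsionPoints ℂ (d + 1 : ℕ))
        (h₂ : G₂ ≤ 𝒥.J.torsionPoints ℂ (d + 1 : ℕ)),
        ¬ 𝒥.IsHyperelliptic →
        IsCyclic G₁ → Nat.card G₁ = d + 1 → IsCyclic G₂ → Nat.card G₂ = d + 1 → G₁ ⊓ G₂ = ⊥ →
        TranslatesInGeneralPosition 𝒥.J Θ (sumSet G₁ G₂) →
        ∀ θ₀ : complexBetti 𝒥.J.X 2, 𝒥.J.IsPolarizationClassOf Θ θ₀ →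
          ∃ γ, IsTwistedCarrierWeilPairOn C
            (fun n X₀ I E => Summit.Ventures.HSemireg.gluableSigmaAdmissible n X₀ I E ∨ bfSingleAdmissible' n X₀ I E)
            𝒥.J hP.isAmple hP.KTheta_eq_bot G₁ G₂ (Nat.succ_ne_zero d) h₁ h₂ d
            (secantPolarizationClass 𝒥.J hP.isAmple G₁ G₂ (Nat.succ_ne_zero d) h₁ h₂ d θ₀) γ := by
  sorry

/-- **Off′(C) DERIVED from 2ℓ′** (`SecantQuotientPinnedAnchorLevelTransfer63OffHyperellipticPinnedPrime C`, ring2-b03 g87's off-hyperelliptic half of G1♭′) —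
p590722's `offHyperellipticPinnedPrime_of_markmanPinnedForall`; hypothesis form. -/
theorem offHypPinnedPrime_of_stub : ∀ C : ChernCharacterBetti,
    SecantQuotientPinnedAnchorLevelTransfer63OffHyperellipticPinnedPrime C :=
  fun C ↦ offHyperellipticPinnedPrime_of_markmanPinnedForall C (stub_markmanPinnedForall_TwPrime C)

/-- **2a′₀ᵒ DERIVED from 2ℓ′ ALONE** (no seed, no transfer; p590722's `oneCarried_63_twPrime_at_presentedOffHyperelliptic_of_markmanPinnedForall`): at every
pinned anchor PRESENTED BY A NON-HYPERELLIPTIC DATUM some pinned-served class is carried by a `tw C AdmTw′`-datum. (v3.6's stub 2a′₀ over ALL pinned anchors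
= this ∧ At′ modulo L1″; At′ left the route per D1b.) -/
theorem oneCarried_63_offHyp_of_stub : ∀ C : ChernCharacterBetti,
    ∀ (Y : SchemeOver ℂ) (θ : complexBetti Y 2),
      (secantQuotientAnchorsPinned Y θ ∧ ∃ (D : SecantQuotientDatum) (e : Y ≅ D.Y.X) (θ₀ : complexBetti D.𝒥.J.X 2),
        ¬ D.𝒥.IsHyperelliptic ∧ D.𝒥.J.IsPolarizationClassOf D.Θ θ₀ ∧ complexBetti.map e.inv 2 θ = D.hY θ₀) →
      ∃ γ₁ ∈ secantQuotientServedClassesPinned Y θ,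
        γ₁ ∈ Summit.HodgeConjecture.HodgeConjecture.Ring2.AbelianAll.carriedClasses
          (twistedReflexiveClass C (fun n X₀ I E => Summit.Ventures.HSemireg.gluableSigmaAdmissible n X₀ I E ∨ bfSingleAdmissible' n X₀ I E)) 6 3 Y θ :=
  fun C Y θ h ↦ oneCarried_63_twPrime_at_presentedOffHyperelliptic_of_markmanPinnedForall C (stub_markmanPinnedForall_TwPrime C) Y θ h.2

/-- STUB 2m′ᵒ (= R12.3's 2m′ — the route's T3 PLAN-ONLY designate — with the anchor family restricted to OFF-HYPERELLIPTIC PRESENTATIONS per R12.5 D1b;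
THE MOVER — in-house, NOT print: T1 #35 (`C_u^∨`) + THEOREM M (a) (`W_ℚ(Y₄) = ℚγ₀ ⊕ ℚγ₁`) + THEOREM T ×2 (`(ḡ_u)_*𝓔̄`, `u = 2+φ₄` at `d = 4`, d-uniform
`u = 3+φ_d`, is `AdmTw′`-admissible iff `𝓔̄` is — ring2-b03x g7 #6, refute-markman #9 PASS with wording objection O₁)): at every pinned anchor presented
by a non-hyperelliptic datum, ONE carried pinned-served class `γ₁` ⟹ a SECOND carried pinned-served class `γ₂`, the two spanning `𝔖^pin` modulo `θ³`.
HOLDS ON PAPER at `d = 4` conditional on L1″ ∧ (C_u^∨)₄-in-degree-2 at the §4.4-generic datum (O₁: off the §4.4-open set — non-hyperelliptic `C` with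
`p ≠ q`, `4(p−q) ∼ 0` or `8(p−q) ∼ 0` — the pair «`𝓔̄` alive, mover dead» is UNDECIDED; that set lies INSIDE this stub's domain); typing-bound — no
kernel object for `𝓔̄`, `ḡ_u` or the push-forward. Why it might fail: the span clause presumes `rk_ℚ 𝔖^pin(Y, θ) = 2` modulo `θ³` at every such anchor
(THEOREM M (a) is print's `d = 4` datum); at special non-hyperelliptic data both carriers may die together or the mover alone (O₁); even `d ≥ 6` is (R3). -/
theorem stub_secondCarried_63_secantQuotientPinnedOffHypPrime : ∀ C : ChernCharacterBetti,
    ∀ (Y : SchemeOver ℂ) (θ : complexBetti Y 2), secantQuotientAnchorsPinned Y θ →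
      (∃ (D : SecantQuotientDatum) (e : Y ≅ D.Y.X) (θ₀ : complexBetti D.𝒥.J.X 2),
        ¬ D.𝒥.IsHyperelliptic ∧ D.𝒥.J.IsPolarizationClassOf D.Θ θ₀ ∧ complexBetti.map e.inv 2 θ = D.hY θ₀) →
      ∀ γ₁ ∈ secantQuotientServedClassesPinned Y θ,
        γ₁ ∈ Summit.HodgeConjecture.HodgeConjecture.Ring2.AbelianAll.carriedClasses
          (twistedReflexiveClass C (fun n X₀ I E => Summit.Ventures.HSemireg.gluableSigmaAdmissible n X₀ I E ∨ bfSingleAdmissible' n X₀ I E)) 6 3 Y θ →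
        ∃ γ₂ ∈ secantQuotientServedClassesPinned Y θ,
          γ₂ ∈ Summit.HodgeConjecture.HodgeConjecture.Ring2.AbelianAll.carriedClasses
            (twistedReflexiveClass C (fun n X₀ I E => Summit.Ventures.HSemireg.gluableSigmaAdmissible n X₀ I E ∨ bfSingleAdmissible' n X₀ I E)) 6 3 Y θ ∧
          ∀ γ ∈ secantQuotientServedClassesPinned Y θ, ∃ x y z : ℂ, γ = x • γ₁ + y • γ₂ + z • cupPowTwo θ 3 := by
  sorry

/-- **2s′ᵒ DERIVED** — `AnchoredSpanAt (tw C AdmTw′) 6 3 𝔄^{pin,off} 𝔖^pin (𝔖^pin + ℂθ³)` from 2a′₀ᵒ (i.e. 2ℓ′) and 2m′ᵒ, by ring2-b03x g7's generic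
`anchoredSpanAt_served_of_two_carried_served` (p587622; any anchor predicate). -/
theorem anchoredSpan_63_secantQuotientPinnedOffHypPrime_of_stubs : ∀ C : ChernCharacterBetti,
    AnchoredSpanAt (twistedReflexiveClass C (fun n X₀ I E => Summit.Ventures.HSemireg.gluableSigmaAdmissible n X₀ I E ∨ bfSingleAdmissible' n X₀ I E)) 6 3
      (fun Y θ ↦ secantQuotientAnchorsPinned Y θ ∧ ∃ (D : SecantQuotientDatum) (e : Y ≅ D.Y.X) (θ₀ : complexBetti D.𝒥.J.X 2),
              ¬ D.𝒥.IsHyperelliptic ∧ D.𝒥.J.IsPolarizationClassOf D.Θ θ₀ ∧ complexBetti.map e.inv 2 θ = D.hY θ₀)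
      (fun Y θ ↦ secantQuotientServedClassesPinned Y θ)
      (fun Y θ ↦ {w | ∃ γ, (γ = 0 ∨ γ ∈ secantQuotientServedClassesPinned Y θ) ∧ ∃ z : ℂ, w = γ + z • cupPowTwo θ 3}) :=
  fun C ↦ anchoredSpanAt_served_of_two_carried_served fun Y θ hY ↦ by
    obtain ⟨hpin, hpres⟩ := hY
    obtain ⟨γ₁, hγ₁, hc₁⟩ := oneCarried_63_offHyp_of_stub C Y θ ⟨hpin, hpres⟩
    obtain ⟨γ₂, hγ₂, hc₂, hspan⟩ := stub_secondCarried_63_secantQuotientPinnedOffHypPrime C Y θ hpin hpres γ₁ hγ₁ hc₁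
    exact ⟨γ₁, hγ₁, γ₂, hγ₂, hc₁, hc₂, hspan⟩

/-- STUB 2r′ᵒ (= 2r′ re-domained per R12.5 D1b; size XL, research; the HONEST LOCAL RESIDUAL, by pairs; NO object proposed): every pair `(X, w)` — `X`
isomorphic to an abelian sixfold, `w` rational of type `(3,3)` — that is NEITHER algebraic-Lefschetz NOR anchor-reachable FROM THE OFF-HYPERELLIPTIC-PRESENTED
pinned secant–quotient anchors (case-(A) pencil: every rational pinned Weil class of the anchor extends globally) is `LocallyServedAt` for the primed
twisted door. Content: (R3) general even `d ≥ 6` second directions; Weil type outside print's components; non-Weil exceptional classes; pairs with a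
non-`θ³` Lefschetz part; unreachable fibres ((h1)'s two branches), now including any hyperelliptic-presented anchor no pencil from the off-hyperelliptic
ones reaches (expected: none — density of the off-hyperelliptic presentations in the irreducible level family; this is the D1b consumer check). Why it
might fail: no carrier and no transport family is known for any of these pairs; lane R's K-class corner is exhausted (THEOREM F). -/
theorem stub_localResidualPairs_63_OffHypTwPrime : ∀ C : ChernCharacterBetti,
    ∀ (X : SchemeOver ℂ), (∃ A' : AbelianVariety ℂ, A'.dim = 6 ∧ Nonempty (A'.X ≅ X)) →
      ∀ w : complexBetti X (2 * 3), IsRationalClass w → IsOfHodgeType 6 X (2 * 3) 3 3 w →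
        ¬ (w ∈ algebraicClasses X 3 ∧ w ∈ divisorClassesSpan X 6 3) →
        ¬ AnchorReachableAt 6 3
            (fun Y θ ↦ secantQuotientAnchorsPinned Y θ ∧ ∃ (D : SecantQuotientDatum) (e : Y ≅ D.Y.X) (θ₀ : complexBetti D.𝒥.J.X 2),
              ¬ D.𝒥.IsHyperelliptic ∧ D.𝒥.J.IsPolarizationClassOf D.Θ θ₀ ∧ complexBetti.map e.inv 2 θ = D.hY θ₀)
            (fun Y θ ↦ secantQuotientServedClassesPinned Y θ)
            (fun Y θ ↦ {w | ∃ γ, (γ = 0 ∨ γ ∈ secantQuotientServedClassesPinned Y θ) ∧ ∃ z : ℂ, w = γ + z • cupPowTwo θ 3}) X w →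
        LocallyServedAt (twistedReflexiveClass C (fun n X₀ I E => Summit.Ventures.HSemireg.gluableSigmaAdmissible n X₀ I E ∨ bfSingleAdmissible' n X₀ I E)) 6 3 X w := by
  sorry

/-- STUB 3′ᴸ (size XL, research; the TAIL, local form): regime 2 in local-in-the-fibre form over the PRIMED twisted door at every diagonal cell
`(2m, m)`, `m ≥ 4` — no print contact. -/
theorem stub_diagonalTailTwPrimeLocal : ∀ (C : ChernCharacterBetti) (m : ℕ), 4 ≤ m →
    LefAtExceptionalRegimeAtLocal (twistedReflexiveClass C (fun n X₀ I E => Summit.Ventures.HSemireg.gluableSigmaAdmissible n X₀ I E ∨ bfSingleAdmissible' n X₀ I E)) (2 * m) m := by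
  sorry

/-- **The `(6,3)` cell in local form from 2s′ᵒ and 2r′ᵒ** — ONE term of ab-andre-2 g66's (G2) `lefAtExceptionalRegimeAtLocal_of_anchoredSpan_of_residual`
(p583871, generic in the anchor family — THE consumer of the D1b check) with the primed door's iso-respect `twistedDoorPrime_respectsIso` (ring2-b06 g120);
kernel-checked, hypothesis form. -/
theorem localCell_sixfoldMiddleOffHypTwPrime_of_cells
    (h₂ₛ : ∀ C : ChernCharacterBetti,
      AnchoredSpanAt (twistedReflexiveClass C (fun n X₀ I E => Summit.Ventures.HSemireg.gluableSigmaAdmissible n X₀ I E ∨ bfSingleAdmissible' n X₀ I E)) 6 3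
        (fun Y θ ↦ secantQuotientAnchorsPinned Y θ ∧ ∃ (D : SecantQuotientDatum) (e : Y ≅ D.Y.X) (θ₀ : complexBetti D.𝒥.J.X 2),
              ¬ D.𝒥.IsHyperelliptic ∧ D.𝒥.J.IsPolarizationClassOf D.Θ θ₀ ∧ complexBetti.map e.inv 2 θ = D.hY θ₀)
        (fun Y θ ↦ secantQuotientServedClassesPinned Y θ)
        (fun Y θ ↦ {w | ∃ γ, (γ = 0 ∨ γ ∈ secantQuotientServedClassesPinned Y θ) ∧ ∃ z : ℂ, w = γ + z • cupPowTwo θ 3}))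
    (h₂ᵣ : ∀ C : ChernCharacterBetti,
      ∀ (X : SchemeOver ℂ), (∃ A' : AbelianVariety ℂ, A'.dim = 6 ∧ Nonempty (A'.X ≅ X)) →
        ∀ w : complexBetti X (2 * 3), IsRationalClass w → IsOfHodgeType 6 X (2 * 3) 3 3 w →
          ¬ (w ∈ algebraicClasses X 3 ∧ w ∈ divisorClassesSpan X 6 3) →
          ¬ AnchorReachableAt 6 3
              (fun Y θ ↦ secantQuotientAnchorsPinned Y θ ∧ ∃ (D : SecantQuotientDatum) (e : Y ≅ D.Y.X) (θ₀ : complexBetti D.𝒥.J.X 2),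
              ¬ D.𝒥.IsHyperelliptic ∧ D.𝒥.J.IsPolarizationClassOf D.Θ θ₀ ∧ complexBetti.map e.inv 2 θ = D.hY θ₀)
              (fun Y θ ↦ secantQuotientServedClassesPinned Y θ)
              (fun Y θ ↦ {w | ∃ γ, (γ = 0 ∨ γ ∈ secantQuotientServedClassesPinned Y θ) ∧ ∃ z : ℂ, w = γ + z • cupPowTwo θ 3}) X w →
          LocallyServedAt (twistedReflexiveClass C (fun n X₀ I E => Summit.Ventures.HSemireg.gluableSigmaAdmissible n X₀ I E ∨ bfSingleAdmissible' n X₀ I E)) 6 3 X w) :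
    ∀ C : ChernCharacterBetti,
      LefAtExceptionalRegimeAtLocal (twistedReflexiveClass C (fun n X₀ I E => Summit.Ventures.HSemireg.gluableSigmaAdmissible n X₀ I E ∨ bfSingleAdmissible' n X₀ I E)) 6 3 :=
  fun C ↦ lefAtExceptionalRegimeAtLocal_of_anchoredSpan_of_residual (twistedDoorPrime_respectsIso C) (h₂ₛ C) (h₂ᵣ C)

/-- **BC3 composition, hypothesis form (local)** — first cell (single ⟹ local), the `(6,3)` cell in local form, the tail give the LOCAL crux
statement spelled out (case split on `m`). -/
theorem twPrimeAtDiagLocal_of_cells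
    (h₁ : ∀ C : ChernCharacterBetti,
      LefAtExceptionalRegimeAt (twistedReflexiveClass C (fun n X₀ I E => Summit.Ventures.HSemireg.gluableSigmaAdmissible n X₀ I E ∨ bfSingleAdmissible' n X₀ I E)) 4 2)
    (h₂ : ∀ C : ChernCharacterBetti,
      LefAtExceptionalRegimeAtLocal (twistedReflexiveClass C (fun n X₀ I E => Summit.Ventures.HSemireg.gluableSigmaAdmissible n X₀ I E ∨ bfSingleAdmissible' n X₀ I E)) 6 3)
    (h₃ : ∀ (C : ChernCharacterBetti) (m : ℕ), 4 ≤ m →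
      LefAtExceptionalRegimeAtLocal (twistedReflexiveClass C (fun n X₀ I E => Summit.Ventures.HSemireg.gluableSigmaAdmissible n X₀ I E ∨ bfSingleAdmissible' n X₀ I E)) (2 * m) m) :
    ∀ (C : ChernCharacterBetti) (m : ℕ), 2 ≤ m →
      LefAtExceptionalRegimeAtLocal (twistedReflexiveClass C (fun n X₀ I E => Summit.Ventures.HSemireg.gluableSigmaAdmissible n X₀ I E ∨ bfSingleAdmissible' n X₀ I E)) (2 * m) m := by
  intro C m hm
  rcases Nat.lt_or_ge m 4 with hlt | hge
  · interval_cases m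
    · exact lefAtExceptionalRegimeAtLocal_of_lefAtExceptionalRegimeAt (h₁ C)
    · exact h₂ C
  · exact h₃ C m hge

/-- **BC3 composition** — concludes the ROUTE DECL `SemiregularSheafRepresentativesTwPrimeAtDiagLocal` BY NAME from the FIVE REGISTERED stubs (1′, 2ℓ′ and 2m′ᵒ via the
derived 2s′ᵒ, 2r′ᵒ, 3′ᴸ); no hypothesis; `sorryAx` reaches it only through `stub_*`. -/
theorem SemiregularSheafRepresentativesTwPrimeAtDiagLocal_of :
    Summit.HodgeConjecture.HodgeConjecture.Theses.VHCAbelianSchemesRoad.SemiregularSheafRepresentativesTwPrimeAtDiagLocal :=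
  twPrimeAtDiagLocal_of_cells stub_firstCell_fourfoldMiddleTwPrime
    (localCell_sixfoldMiddleOffHypTwPrime_of_cells anchoredSpan_63_secantQuotientPinnedOffHypPrime_of_stubs stub_localResidualPairs_63_OffHypTwPrime)
    stub_diagonalTailTwPrimeLocal

/- NOT RESTATED (so that the ONLY theorem of this file concluding the route decl is `…_of`): parent edges 20707 ⟹ 23112 ⟹ 23176
(`lefAtExceptionalRegimeAtAdd_of_lefAtExceptionalRegimeAt`, `exceptionalRegimeAtLocal_admTw'_diagonal_of_exceptionalRegimeAtAdd`,
`lefAtExceptionalRegimeAtLocal_of_lefAtExceptionalRegimeAt`); v3.6's full-pinned 2a′₀ = L1″ ∧ G1♭′ (`oneCarried_63_twPrime_iff_pinnedLevelTransfer63PinnedPrime_of_markmanPinned`,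
p590217) = L1″ ∧ L1″_∀ ∧ At′ (`oneCarried_63_twPrime_of_markmanPinned_of_markmanPinnedForall_of_atHyperelliptic`, p590722) — the D1a alternative; At′
(`SecantQuotientPinnedAnchorLevelTransfer63AtHyperellipticPinnedPrime`) is OFF the route under D1b and stays a named tree node for refuters. -/

#print axioms localCell_sixfoldMiddleOffHypTwPrime_of_cells
#print axioms twPrimeAtDiagLocal_of_cells
#print axioms SemiregularSheafRepresentativesTwPrimeAtDiagLocal_of

end Summit.HodgeConjecture.HodgeConjecture.Cruxes.SemiregularSheafRepresentativesTwPrimeAtDiagLocal.Birth
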